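import Summits.HubbardSuperconductivity.HubbardSuperconductivity.Theorems.NodalWardXYPerturbedXYOrderEquivalence

/-!
# STRATEGY-CENSUS companion, strategist r1 (crux stmt-HubbardSuperconductivity-10739 `NodalWardXY.PerturbedXYOrder`)

Typed forms of the NEW census attempts of the REDIRECT second-opinion seat
`planner-cstrat-stmt-HubbardSuperconductivity-10739-r1-0` (`Cruxes/PerturbedXYOrder/STRATEGY-CENSUS.md`, revision r1,
§§ Transfer T12–T18 / Strengthen S8–S10 / Decomposition D9–D10 / Negation N12–N14), over the landed vocabulary
`Theorems/NodalWardXYDefs.lean` (`Bond`, `cube`, `cur`, `wJ`, `Wk`, `Zk`, `cratio`, `Admissible`).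
Definitions (statements as signatures) plus ONE elementary implication from the crux; NO `sorry`.

* §Strengthen S9 — `RealTiltPlateauXY3`: the crux restricted to REAL kernels, plateau clause only (`Z_K > 0` is then
  automatic).  `realTiltPlateau_of_perturbedXYOrder : PerturbedXYOrder → RealTiltPlateauXY3` (instantiation).  The census
  shows that even this positivity-restored corner is "long-range order WITHOUT reflection positivity for a generic
  (non-Ginibre) gradient perturbation of the 3-D plane rotator" — not in print by any method (Peled–Spinka 2019 p. 29 list:
  FSS = RP; Fröhlich–Spencer 1982 / Kennedy–King 1986 = positive dual or flow weights, destroyed by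
  `sin∇θ·sin∇θ' = ½cos(∇θ−∇θ') − ½cos(∇θ+∇θ')`; Balaban = the engine).  So the language switch "do the real kernels first"
  has no teeth: its first open statement is already Balaban-class.
* §Decomposition D9 — `TiltedInfraredBoundXY3` + `SumRuleGlueXY3`: the plateau half of the crux is EXACTLY reducible, by the
  spin-length sum rule `Σ_p ĝ_K(p) = L³` (which survives complex tilting because `|s_x| = 1` pointwise and the tilted
  "state" is linear and normalised), to UPPER bounds on the tilted structure factor at NON-ZERO momenta,
  `‖ĝ_K(p)‖ ≤ C/(J ε(p))` — the complex-tilt analogue of the Fröhlich–Simon–Spencer infrared bound.  Honest split shape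
  (neither piece is the crux; per-piece probes fail on paper), glue provable (character orthogonality on `(ℤ/Lℤ)³` + the
  `d = 3` lattice Green-function bound already inside `realPlateau`), but the open piece is Gaussian domination for a
  non-reflection-positive complex state: engine-class, no plan ⇒ NOT filed (`route edit --split` would re-seat leads on an
  engine statement under a new name, the loop HANDBACK-c5 §0.3 / census p1 §5 / c17 §4 / c21 §3 asked to stop).
* §Strengthen S10 — `DiamagneticCurrentBoundXY`: the flow (character) expansion with `I_m(J) > 0` gives `|Z(A)| ≤ Z(0)` for
  every real gauge field `A`, hence (second order at `A = 0`) the NON-PERTURBATIVE operator-norm bound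
  `⟨(Σ_b a_b j_b)²⟩_J ≤ J⁻¹ Σ_b a_b² ⟨cos∇_bθ⟩_J ≤ ‖a‖²/J` on the current covariance of the REAL rotator, all `J > 0`, all `L`
  (the "bond-space accretivity" that HANDBACK-c21 T11(ii) believed to be available only at the Gaussian level is exact).
  TRUE (paper proof in the census; already named as an a-priori tool in `Ideas/schwarz-inheritance.md` ll. 90–92), typed
  here as a statement; why it buys nothing for THIS step: domination inequalities are UPPER bounds on `|⟨e^{⟨a,j⟩}⟩|`,
  zero-freeness needs LOWER bounds.
* §Negation N12 — `ImaginarySourcePositivityXY`: for purely IMAGINARY linear current sources of sup-norm `< J` the torus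
  partition function is real and POSITIVE (Fourier coefficients `I_m(√(J²−s²))·((J+s)/(J−s))^{m/2} > 0`), acquiring
  Bessel-`J_m` sign changes only beyond `|s_b| > J`; the Kac–Siegert / Fresnel unfolding of a genuinely complex two-current
  kernel produces MIXED real+imaginary sources, for which coefficient positivity fails at second order — the precise point
  where the positivity of T12 ends (sharpens census T9(2)).  TRUE, typed as a statement.

BC2-style probes run by this seat (`bc/PerturbedXYOrder_probe.lean`, farm rc 1): `PerturbedXYOrder → HubbardSuperconductivity`
FAILS (battery `exact? | simpa | unfold;simpa | aesop` exhausts 400 000 heartbeats, no term) and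
`HubbardSuperconductivity → PerturbedXYOrder` FAILS (unsolved goal `⊢ PerturbedXYOrder`, aesop exhaustive search failed):
the crux is neither summit-strength nor a consequence of the summit; it is ENGINE-strength
(`perturbedXYOrder_iff_complexStability` p106199, `perturbedXYOrder_iff_cumulantBounds` p106870).
-/

noncomputable section

set_option linter.dupNamespace false

namespace Summit.HubbardSuperconductivity.HubbardSuperconductivity.Cruxes.PerturbedXYOrder.StrategyCensusR1

open MeasureTheory Literature.Probability.LatticeModels
open Summit.HubbardSuperconductivity.HubbardSuperconductivity.Theses.NodalWardXY
open Summit.HubbardSuperconductivity.HubbardSuperconductivity.Theorems.PerturbedXYOrder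

/-! ### §Strengthen S9 — the real-kernel plateau (positivity restored, still engine-class) -/

/-- A real kernel viewed as a complex one. -/
def ofRealKernel {L : ℕ} (κ : Bond L → Bond L → ℝ) : Bond L → Bond L → ℂ := fun b b' => ((κ b b' : ℝ) : ℂ)

/-- **S9 `RealTiltPlateauXY3`** — the crux restricted to REAL admissible kernels `κ`, plateau clause only: for `J ≥ J₀`,
all `L ≥ 2` and all real `κ` with `|κ(b,b')| ≤ ε(1+dist)⁻⁴`, the (now genuinely probabilistic, positive-weight, but NOT
reflection-positive and NOT Ginibre-ferromagnetic) tilted rotator `∝ exp(JΣcos∇θ + Σκ j_b j_{b'}) dθ` has torus plateau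
`Re cratio ≥ a`.  A WEAKENING of the crux (`realTiltPlateau_of_perturbedXYOrder`); the real SLICE (real `K`, both clauses) was
typed earlier by the standing disprover as `PerturbedXYOrderReal` (`Cruxes/PerturbedXYOrder/Disproof.lean` §2) with the same
diagnosis; census §Strengthen S9 adds the printed-method placement: it is "LRO without reflection positivity" for a generic
gradient perturbation of the 3-D rotator — not in print. -/
def RealTiltPlateauXY3 : Prop :=
  ∃ J₀ ε a : ℝ, 0 < ε ∧ 0 < a ∧ ∀ J : ℝ, J₀ ≤ J → ∀ (L : ℕ) [NeZero L], 2 ≤ L →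
    ∀ κ : Bond L → Bond L → ℝ, Admissible L ε (ofRealKernel κ) → a ≤ (cratio L J (ofRealKernel κ)).re

/-- The crux implies its real-kernel plateau corner (instantiate the complex kernel at a real one). -/
theorem realTiltPlateau_of_perturbedXYOrder (h : PerturbedXYOrder) : RealTiltPlateauXY3 := by
  rw [perturbedXYOrder_iff] at h
  obtain ⟨J₀, ε, a, hε, ha, h⟩ := h
  exact ⟨J₀, ε, a, hε, ha, fun J hJ L _ hL κ hκ => (h J hJ L hL (ofRealKernel κ) hκ).2⟩

/-! ### §Decomposition D9 — the sum-rule split of the plateau half -/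

/-- The tilted (complex, normalised) two-point value `⟨cos(θ_x − θ_y)⟩_K = ∫ cos(θ_x−θ_y) w_J e^{W_K} / Z_K`. -/
def texp2 {L : ℕ} [NeZero L] (J : ℝ) (K : Bond L → Bond L → ℂ) (x y : TorusSite 3 L) : ℂ :=
  (∫ θ in cube L, (Real.cos (θ x - θ y) : ℂ) * (wJ J θ * Complex.exp (Wk K θ))) / Zk J K

/-- The phase `2π p·(x − y)/L` of the character of `(ℤ/Lℤ)³` indexed by `p`, evaluated at `x − y`
(representatives `ZMod.val`; the cosine below is `L`-periodic in them, so the choice is immaterial). -/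
def phase {L : ℕ} (p x y : TorusSite 3 L) : ℝ :=
  2 * Real.pi * (∑ i : Fin 3, ((p i).val : ℝ) * (((x i).val : ℝ) - ((y i).val : ℝ))) / (L : ℝ)

/-- The tilted structure factor `ĝ_K(p) = L⁻³ Σ_{x,y} cos(2πp·(x−y)/L) ⟨cos(θ_x − θ_y)⟩_K` (complex for complex `K`;
at `K = 0` it is `⟨|ŝ(p)|²⟩`, both spin components).  Sum rule: `Σ_p ĝ_K(p) = Σ_x ⟨1⟩_K = L³` whenever `Z_K ≠ 0`
(character orthogonality; `cos(θ_x − θ_x) = 1`), and `ĝ_K(0) = L³ · cratio L J K`. -/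
def sfK {L : ℕ} [NeZero L] (J : ℝ) (K : Bond L → Bond L → ℂ) (p : TorusSite 3 L) : ℂ :=
  (∑ x : TorusSite 3 L, ∑ y : TorusSite 3 L, (Real.cos (phase p x y) : ℂ) * texp2 J K x y) / ((L : ℂ) ^ 3)

/-- The lattice dispersion `ε(p) = Σ_i (1 − cos(2π p_i/L))` (vanishes only at `p = 0`). -/
def disp {L : ℕ} (p : TorusSite 3 L) : ℝ :=
  ∑ i : Fin 3, (1 - Real.cos (2 * Real.pi * ((p i).val : ℝ) / (L : ℝ)))

/-- **D9 Sub₂′ `TiltedInfraredBoundXY3`** — the complex-tilt analogue of the Fröhlich–Simon–Spencer infrared bound: along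
every zero-free doubled admissible ray, the tilted structure factor at NON-ZERO momentum is bounded by `C/(J ε(p))`,
uniformly in the volume.  At `K = 0` this is FSS 1976 with `C = 1` (Gaussian domination by reflection positivity).  For
complex `K` there is no reflection positivity and the "bound" concerns a ratio of two complex integrals each of size
`e^{O(εL³)}`: engine-class (census D9).  Neither this statement nor `ZeroFreeXY3'` alone gives the crux. -/
def TiltedInfraredBoundXY3 : Prop :=
  ∃ J₀ ε C : ℝ, 0 < ε ∧ 0 < C ∧ ∀ J : ℝ, J₀ ≤ J → ∀ (L : ℕ) [NeZero L], 2 ≤ L →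
    ∀ K : Bond L → Bond L → ℂ, Admissible L ε K → (∀ t : ℂ, ‖t‖ ≤ 2 → Zk J (t • K) ≠ 0) →
      ∀ p : TorusSite 3 L, p ≠ 0 → ‖sfK J K p‖ ≤ C / (J * disp p)

/-- **D9 Sub₁ `ZeroFreeXY3'`** (= census p1 `ZeroFreeXY3`, restated so that this workfile imports Theorems only):
uniform zero-freeness on the admissible polydisc. -/
def ZeroFreeXY3' : Prop :=
  ∃ J₀ ε₁ : ℝ, 0 < ε₁ ∧ ∀ J : ℝ, J₀ ≤ J → ∀ (L : ℕ) [NeZero L], 2 ≤ L →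
    ∀ K : Bond L → Bond L → ℂ, Admissible L ε₁ K → Zk J K ≠ 0

/-- **D9 glue `SumRuleGlueXY3`** (provable, size M; NOT proved here because the split is not filed): zero-freeness at
radius `ε₁` + the tilted infrared bound at radius `ε` give the crux at radius `min(ε₁/2, ε)` with plateau
`a = 1 − C·W₃/J ≥ 1/2` for `J ≥ max(J₀, 2 C W₃)`, where `W₃ = sup_{L ≥ 2} L⁻³ Σ_{p ≠ 0} ε(p)⁻¹ < ∞` (`d = 3`).  Paper proof:
`Re cratio = Re ĝ_K(0)/L³ = 1 − L⁻³ Re Σ_{p≠0} ĝ_K(p)` by the sum rule, then the bound piece by piece. -/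
def SumRuleGlueXY3 : Prop := ZeroFreeXY3' → TiltedInfraredBoundXY3 → PerturbedXYOrder

/-! ### §Strengthen S10 / §Negation N12 — where flow-expansion positivity lives and where it ends -/

/-- **S10 `DiamagneticCurrentBoundXY`** (TRUE — flow expansion, `I_m(J) > 0`; census S10): for the REAL rotator on every
torus and every `J > 0`, the current field `j_b = sin∇_bθ` is dominated in covariance by `J⁻¹·Id` on `ℓ²(Bond)`:
`∫ (Σ_b a_b j_b)² w_J ≤ J⁻¹ (Σ_b a_b²) ∫ w_J` for all real bond fields `a`.  (Second-order term at `A = 0` of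
`|Z(A)| ≤ Z(0)`, `Z(A) = ∫ exp(JΣ_b cos(∇_bθ − A_b))`; uses `⟨cos∇_bθ⟩_J ≤ 1`.)  An a-priori input for any engine; no
leverage on zero-freeness (upper bounds only). -/
def DiamagneticCurrentBoundXY : Prop :=
  ∀ (L : ℕ) [NeZero L], 2 ≤ L → ∀ J : ℝ, 0 < J → ∀ a : Bond L → ℝ,
    (∫ θ in cube L, (∑ b : Bond L, a b * cur b θ) ^ 2 * (wJ J θ).re) ≤
      (1 / J) * (∑ b : Bond L, a b ^ 2) * ∫ θ in cube L, (wJ J θ).re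

/-- **N12 `ImaginarySourcePositivityXY`** (TRUE — `e^{J cos φ + i s sin φ} = e^{R cos(φ − iβ)}`, `R = √(J² − s²)`,
`tanh β = s/J`, Fourier coefficients `I_m(R) e^{mβ} > 0`; census N12): purely imaginary linear current sources of sup-norm
`< J` never kill — indeed keep POSITIVE — the torus partition function.  Beyond `|s_b| > J` the single-bond coefficients are
`J_m(√(s² − J²)) e^{mκ}` and change sign; a complex two-current kernel unfolds (Kac–Siegert / Fresnel) into sources with
comparable real AND imaginary parts, for which positivity already fails at second order.  No counterexample mechanism
inside the admissible polydisc follows (consistent with census N8). -/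
def ImaginarySourcePositivityXY : Prop :=
  ∀ (L : ℕ) [NeZero L], 2 ≤ L → ∀ J : ℝ, 0 < J → ∀ s : Bond L → ℝ, (∀ b, |s b| < J) →
    0 < (∫ θ in cube L, wJ J θ * Complex.exp (Complex.I * ∑ b : Bond L, ((s b * cur b θ : ℝ) : ℂ))).re

end Summit.HubbardSuperconductivity.HubbardSuperconductivity.Cruxes.PerturbedXYOrder.StrategyCensusR1

end
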